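import Literature.Analysis.ODE.TorusFlowGradientEstimateWithin
import HarnessLib

/-!
# Armstrong–Vicol App. A Prop. 7.11 on a forward window `[0,T₀]` (time-regularity WITHIN the window): the
# `dnorm` packaging `TorusFlow.dnorm_flowGrad_le_forward_ofDerivWithin`

Analysis/ODE proof file (theorems only; no definitions, no named facts). Companion of
`TorusFlowGradientEstimateWithin` (the inductive bound (eq:Dn:Psi:induction) on `[0,T₀]` under the within-window
chain rule `hDt`); this file is §3 of `TorusFlowGradientEstimateOfDeriv` verbatim in that setting:
`⟦(∇X)_{ij}(t,·)⟧_{n, 8dR_f(1+8dC_fR_f t)} ≤ 6d` for `1 ≤ n ≤ N − 1`, `t ∈ [0,T₀]`, `T₀ ≤ 1/(4dC_fR_f)`.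
Consumer: the analytic tower of the Lagrangian carriers of cell `ad-ideate` (K1L_D `stmt-AnomalousDissipation-27980`).

## References

* S. Armstrong, V. Vicol, *Anomalous diffusion by fractal homogenization*, Ann. PDE 11 (2025), arXiv:2305.05048,
  App. A Prop. 7.11 ((e.ODE.flow.estimate), arXiv §7.3 pp. 73–74). [`ArmstrongVicol2025`]
-/

noncomputable section

open Set Function Filter MeasureTheory Finset
open scoped Topology Nat ContDiff

namespace Literature.Analysis.ODE

namespace TorusFlow

open Literature.Analysis.FunctionSpaces Literature.Analysis.FunctionSpaces.Torus

variable {d : Type*} [Fintype d] [DecidableEq d]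

variable {f D : ℝ → UnitAddTorus d → EuclideanSpace ℝ d} {Cf Rf : ℝ} {N : ℕ}

/-! ## §3 The `dnorm` packaging on `[0,T₀]` -/

/-- **Armstrong–Vicol, App. A Prop. 7.11 on the forward window `[0,T₀]`, time-regularity WITHIN the window as
data**: for the flow `X = id + proj∘D` (smooth slices, `∂ₜ∂^l D = ∂^l(f∘X)` within `[0,T₀]` for every word `l`,
`D(0) = 0`) of a field with `⟦f(t)⟧_{n,R_f} ≤ C_f` (`1 ≤ n ≤ N`), every `0 ≤ t ≤ T₀ ≤ 1/(4dC_fR_f)` and `1 ≤ n ≤ N − 1`: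
`⟦(∇X)_{ij}(t,·)⟧_{n, 8dR_f(1+8dC_fR_f t)} ≤ 6d`.
[cite: ArmstrongVicol2025, App. A Prop. 7.11 ((e.ODE.flow.estimate), arXiv §7.3 pp. 73–74)] -/
theorem dnorm_flowGrad_le_forward_ofDerivWithin (hCf : 0 < Cf) (hRf : 0 < Rf)
    (hfs : ∀ t, IsSmooth (f t)) (hDs : ∀ t, IsSmooth (D t)) (hD0 : ∀ x, D 0 x = 0)
    {T₀ : ℝ} (hT₀ : T₀ ≤ 1 / (4 * (Fintype.card d : ℝ) * Cf * Rf))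
    (hDt : ∀ (l : List d) (i : d) (x : UnitAddTorus d), ∀ t ∈ Icc 0 T₀,
      HasDerivWithinAt (fun s => iterPartialDeriv l (fun y => D s y i) x)
        (iterPartialDeriv l (fun y => f t (y + proj (D t y)) i) x) (Icc 0 T₀) t)
    (hfb : ∀ n, 1 ≤ n → n ≤ N → ∀ t, dnorm n Rf (f t) ≤ Cf) :
    ∀ n, 1 ≤ n → n + 1 ≤ N → ∀ t ∈ Icc (0 : ℝ) T₀,
      ∀ i j : d, dnorm n (8 * (Fintype.card d : ℝ) * Rf * (1 + 8 * (Fintype.card d : ℝ) * Cf * Rf * t))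
          (fun y => (1 : Matrix d d ℝ) i j + partialDeriv j (fun x => D t x i) y) ≤
        6 * (Fintype.card d : ℝ) := by
  intro n hn1 hnN t ht i j
  classical
  set dd : ℝ := (Fintype.card d : ℝ) with hdd
  have hdd1 : 1 ≤ dd := by
    have : Nonempty d := ⟨i⟩
    have hcard : 1 ≤ Fintype.card d := Nat.succ_le_of_lt Fintype.card_pos
    rw [hdd]; exact_mod_cast hcard
  set ρ : ℝ := 8 * dd * Rf * (1 + 8 * dd * Cf * Rf * t) with hρ
  have ht0 : 0 ≤ t := ht.1
  have hBt : 8 * dd * Cf * Rf * t ≤ 2 := by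
    have h1 : 8 * dd * Cf * Rf * t ≤ 8 * dd * Cf * Rf * (1 / (4 * dd * Cf * Rf)) :=
      mul_le_mul_of_nonneg_left (ht.2.trans hT₀) (by positivity)
    have h2 : 8 * dd * Cf * Rf * (1 / (4 * dd * Cf * Rf)) = 2 := by field_simp; ring
    linarith
  have hρ0 : 0 < ρ := by positivity
  have hρle : ρ ≤ 24 * dd * Rf := by
    rw [hρ]; nlinarith [hBt, mul_pos (mul_pos (by norm_num : (0:ℝ) < 8) (by linarith : (0:ℝ) < dd)) hRf]
  have hDti : IsSmooth (fun x => D t x i) := (hDs t).apply i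
  refine dnorm_le_of_forall_norm_iterPartialDeriv_le hρ0 (by positivity) fun l hl y => ?_
  obtain ⟨v, rfl⟩ := proj_surjective y
  have hlne : l ≠ [] := by intro h; subst h; simp at hl; omega
  -- `∂^l (δ_ij + ∂_j D_i) = ∂^{l ++ [j]} D_i`
  have e1 : iterPartialDeriv l (fun y => (1 : Matrix d d ℝ) i j + partialDeriv j (fun x => D t x i) y) (proj v) =
      iterPartialDeriv (l ++ [j]) (fun x => D t x i) (proj v) := by
    rw [iterPartialDeriv_concat,
      iterPartialDeriv_add (isSmooth_const ((1 : Matrix d d ℝ) i j)) (hDti.partialDeriv j) l]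
    simp only
    rw [iterPartialDeriv_const ((1 : Matrix d d ℝ) i j) l hlne, Pi.zero_apply, zero_add]
  -- the word `l ++ [j]` of length `n + 1` as `List.ofFn K`
  have hlen : (l ++ [j]).length = n + 1 := by simp [hl]
  set K : Fin (n + 1) → d := fun k => (l ++ [j]).get (Fin.cast hlen.symm k) with hK
  have eK : List.ofFn K = l ++ [j] := by
    refine List.ext_get (by rw [List.length_ofFn, hlen]) fun k h1 h2 => ?_
    rw [List.get_ofFn]
    rfl
  have e2 : iterPartialDeriv (l ++ [j]) (fun x => D t x i) (proj v) =
      (iteratedFDeriv ℝ (n + 1) (fun w => w + lift (D t) w) v (fun k => EuclideanSpace.single (K k) (1 : ℝ))) i := by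
    rw [iteratedFDeriv_inner_eq_iterPartialDeriv (hDs t) (by omega) K v, eK, iterPartialDeriv_apply_coord (hDs t) i]
  have key := abs_iteratedFDeriv_flow_le_forward_ofDerivWithin hCf hRf hfs hDs hD0 hT₀ hDt hfb (n + 1) (by omega) hnN t ht K v i
  rw [Real.norm_eq_abs, e1, e2]
  refine key.trans ?_
  rw [← hdd, ← hρ]
  -- arithmetic: `W_{n+1} ρ^{n+1}/((n+2)² d R_f) ≤ 6d · n! ρⁿ/(n+1)²`
  have hW := four_mul_avWeight_succ_le_factorial hn1
  have hW0 := (avWeight_pos (n + 1)).le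
  set W : ℝ := (1 / 2 : ℝ) * ∏ i ∈ Finset.range (n + 1 - 1), ((i : ℝ) + 1 / 2) with hWdef
  have hn2 : ((n : ℝ) + 1) ^ 2 ≤ (((n + 1 : ℕ) : ℝ) + 1) ^ 2 := by
    push_cast; nlinarith [(Nat.cast_nonneg n : (0 : ℝ) ≤ n)]
  calc W * ρ ^ (n + 1) / ((((n + 1 : ℕ) : ℝ) + 1) ^ 2 * (dd * Rf))
      = (W * ρ) * (ρ ^ n / ((((n + 1 : ℕ) : ℝ) + 1) ^ 2 * (dd * Rf))) := by rw [pow_succ]; ring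
    _ ≤ ((n ! : ℝ) / 4 * (24 * dd * Rf)) * (ρ ^ n / (((n : ℝ) + 1) ^ 2 * (dd * Rf))) := by
        refine mul_le_mul ?_ ?_ (by positivity) (by positivity)
        · exact mul_le_mul (by linarith) hρle hρ0.le (by positivity)
        · exact div_le_div_of_nonneg_left (by positivity) (by positivity)
            (mul_le_mul_of_nonneg_right hn2 (by positivity))
    _ = 6 * ((n ! : ℝ) * ρ ^ n) / ((n : ℝ) + 1) ^ 2 := by field_simp; norm_num
    _ ≤ 6 * dd * ((n ! : ℝ) * ρ ^ n) / ((n : ℝ) + 1) ^ 2 := by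
        refine div_le_div_of_nonneg_right ?_ (by positivity)
        nlinarith [hdd1, show 0 ≤ (n ! : ℝ) * ρ ^ n by positivity]

end TorusFlow

end Literature.Analysis.ODE

end
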